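import Summits.CriticalPhenomena.PercolationContinuityZ3.Theorems.PercNearOneGluingNoHeavyLowerTailRefinedRowR3Switching
import Summits.CriticalPhenomena.PercolationContinuityZ3.Theorems.PercNearOneGluingNoHeavyLowerTailDualBHKBlock
import Mathlib.Combinatorics.SetFamily.FourFunctions
import Mathlib.Tactic.Linarith
import HarnessLib

/-!
# `NoHeavyLowerTail` (stmt-CriticalPhenomena-4575) — THEOREM R2 of the separating-cluster refinement:
# `t · b₀ ≥ s_a · u_a` on EVERY finite weighted graph, by the four functions theorem

Support file (prover prim-gen-kcluster gen 35; `--supports stmt-CriticalPhenomena-4575`).  No named facts, no sorries.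

Setting and cells as in `…RefinedRowR3Switching` (support `D`, masses `PrW D p`, terminals `a b c`, refined cells `cellSa`, `cellB0`,
support separation `Sep`), plus the two remaining cells of the apex `a`: `cellT` (`t`: `b, c ∈ cl X a`) and `cellUa` (`u_a`: `b ~ c`, `a` apart).

* `PrW_fourEvents` — the Ahlswede–Daykin four functions theorem for the finitary masses `PrW D p` (Mathlib's
  `Finset.four_functions_theorem` on `D.powerset` with `fᵢ = 1_{Aᵢ} · wtW`; the product weight is log-modular, `DualBHK.wtW_inter_mul_union`):
  if `S ∈ A₁, T ∈ A₂ ⇒ S ∩ T ∈ A₃, S ∪ T ∈ A₄` for `S, T ⊆ D`, then `PrW A₁ · PrW A₂ ≤ PrW A₃ · PrW A₄`.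
  [cite: AhlswedeDaykin1978, Theorem 1]
* **THEOREM R2** (`r2_PrW`, KCLUSTER-gen32 §4 of run/shared/lean/prim/prim-gen-kcluster/): if `b, c ∈ cl D a` then
  `PrW(cellSa) · PrW(cellUa) ≤ PrW(cellB0) · PrW(cellT)`, i.e. `s_a u_a ≤ b₀ t`.  Pointwise (`pointwise_R2`): for `ω ∈ S_a`, `ω′ ∈ U_a`,
  `ω ∩ ω′ ∈ B_0` (sub-clusters of non-separating clusters; `cl ω b` does not separate `a|c` by `RefinedRowR3.not_sep_sep`) and `ω ∪ ω′ ∈ T`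
  (the `ω′`-open `b–c` path is a support path, so it meets the separator `cl ω a`).
Together with `RefinedRowR3.r3_PrW` this puts two of the three refined quadratic rows of KCLUSTER-gen32 (R2, R3) in the tree; R1
(`u_b u_c ≥ t s_a`) is open.
-/

noncomputable section

namespace Summit.CriticalPhenomena.PercolationContinuityZ3.Theorems

namespace RefinedRowR2

open Finset Literature.Probability.Percolation Literature.Probability.Percolation.DecisionTree
open Literature.Probability.Percolation.Gladkov ThreePointLB RefinedRowR3
open scoped Classical FinsetFamily

/-! ### The four functions theorem for `PrW` -/

section FourFunctions

variable {ι : Type*} [DecidableEq ι]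

/-- **Four functions theorem for `PrW`** (Ahlswede–Daykin on the weighted cube `D.powerset`): if `S ∈ A₁`, `T ∈ A₂`
(`S, T ⊆ D`) force `S ∩ T ∈ A₃` and `S ∪ T ∈ A₄`, then `PrW A₁ · PrW A₂ ≤ PrW A₃ · PrW A₄`.
[cite: AhlswedeDaykin1978, Theorem 1] -/
theorem PrW_fourEvents (D : Finset ι) {p : ι → ℝ} (hp0 : ∀ i, 0 ≤ p i) (hp1 : ∀ i, p i ≤ 1)
    (A₁ A₂ A₃ A₄ : Set (Finset ι))
    (h : ∀ S, S ⊆ D → ∀ T, T ⊆ D → S ∈ A₁ → T ∈ A₂ → S ∩ T ∈ A₃ ∧ S ∪ T ∈ A₄) :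
    PrW D p A₁ * PrW D p A₂ ≤ PrW D p A₃ * PrW D p A₄ := by
  have hw : ∀ S, 0 ≤ wtW D p S := fun S => wtW_nonneg D hp0 hp1 S
  have hnn : ∀ (A : Set (Finset ι)), 0 ≤ A.indicator (wtW D p) := fun A S =>
    Set.indicator_nonneg (fun T _ => hw T) S
  have key := Finset.four_functions_theorem D (f₁ := A₁.indicator (wtW D p)) (f₂ := A₂.indicator (wtW D p))
    (f₃ := A₃.indicator (wtW D p)) (f₄ := A₄.indicator (wtW D p)) (hnn A₁) (hnn A₂) (hnn A₃) (hnn A₄) ?_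
    (𝒜 := D.powerset) (ℬ := D.powerset) subset_rfl subset_rfl
  · simp only [powerset_infs_powerset_self, powerset_sups_powerset_self] at key
    unfold PrW
    exact key
  intro S hS T hT
  by_cases h1 : S ∈ A₁
  · by_cases h2 : T ∈ A₂
    · obtain ⟨h3, h4⟩ := h S hS T hT h1 h2
      rw [Set.indicator_of_mem h1, Set.indicator_of_mem h2, Set.indicator_of_mem h3, Set.indicator_of_mem h4,
        DualBHK.wtW_inter_mul_union]
    · rw [Set.indicator_of_notMem h2, mul_zero]
      exact mul_nonneg (hnn A₃ _) (hnn A₄ _)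
  · rw [Set.indicator_of_notMem h1, zero_mul]
    exact mul_nonneg (hnn A₃ _) (hnn A₄ _)

end FourFunctions

/-! ### The two remaining apex cells and the pointwise lattice lemma -/

variable {V : Type*} [Fintype V] [DecidableEq V]

section Cells

variable (a b c : V)

/-- `T` (`abc` seen from the apex): `b, c ∈ cl X a`. [this work] -/
def cellT : Set (Finset (Sym2 V)) := {X | b ∈ cl X a ∧ c ∈ cl X a}

/-- `U_a` (`a|bc`): `a` apart from `b` and `c`, and `b ~ c`. [this work] -/
def cellUa : Set (Finset (Sym2 V)) := {X | b ∉ cl X a ∧ c ∉ cl X a ∧ c ∈ cl X b}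

variable {a b c}

omit [DecidableEq V] in
/-- Membership in `cellT`. [this work] -/
@[simp] theorem mem_cellT {X : Finset (Sym2 V)} : X ∈ cellT a b c ↔ b ∈ cl X a ∧ c ∈ cl X a := Iff.rfl
omit [DecidableEq V] in
/-- Membership in `cellUa`. [this work] -/
@[simp] theorem mem_cellUa {X : Finset (Sym2 V)} : X ∈ cellUa a b c ↔ b ∉ cl X a ∧ c ∉ cl X a ∧ c ∈ cl X b := Iff.rfl

end Cells

/-- **Pointwise lattice lemma for R2** (KCLUSTER-gen32 §4): for `ω ∈ S_a` and `ω′ ∈ U_a` inside a support joining the terminals,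
`ω ∩ ω′ ∈ B_0` and `ω ∪ ω′ ∈ T`. [this work] -/
theorem pointwise_R2 {D : Finset (Sym2 V)} {a b c : V} {X Y : Finset (Sym2 V)} (hXD : X ⊆ D) (hYD : Y ⊆ D)
    (hDb : b ∈ cl D a) (hDc : c ∈ cl D a) (hX : X ∈ cellSa D a b c) (hY : Y ∈ cellUa a b c) :
    X ∩ Y ∈ cellB0 D a b c ∧ X ∪ Y ∈ cellT a b c := by
  obtain ⟨⟨hab, hac, hbc⟩, hsep⟩ := hX
  obtain ⟨hYab, hYac, hYbc⟩ := hY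
  set K := cl X a with hK
  -- the Y-open b–c path is a support path, so it meets the separator K
  obtain ⟨v, hvY, hvK⟩ : ∃ v, v ∈ cl Y b ∧ v ∈ K := by
    by_contra hcon
    push Not at hcon
    exact hsep (cl_subset_cl_sdiff_touch hYD hcon hYbc)
  refine ⟨⟨⟨?_, ?_, ?_⟩, ?_, ?_, ?_⟩, ?_, ?_⟩
  · exact fun h => hYab (cl_mono Finset.inter_subset_right a h)
  · exact fun h => hYac (cl_mono Finset.inter_subset_right a h)
  · exact fun h => hbc (cl_mono Finset.inter_subset_left b h)
  · -- cl (X ∩ Y) a ⊆ cl Y a, which misses the Y-cluster of b ∋ c: no separation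
    intro h
    have h' : Sep D (cl Y a) b c := h.mono (cl_mono Finset.inter_subset_right a)
    exact h' (cl_subset_cl_sdiff_touch hYD (fun u hu => not_mem_cl_of_mem_cl hu fun h'' => hYab (mem_cl_comm.1 h'')) hYbc)
  · intro h
    exact not_sep_sep hXD hab hDc hsep (h.mono (cl_mono Finset.inter_subset_left b))
  · intro h
    have h' : Sep D (cl X c) a b := h.mono (cl_mono Finset.inter_subset_left c)
    exact not_sep_sep (x := a) (y := c) (z := b) hXD hac hDb (sep_comm.1 hsep) h'
  · -- b ∈ cl (X ∪ Y) a via v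
    have hav : v ∈ cl (X ∪ Y) a := cl_mono Finset.subset_union_left a hvK
    have hvb : b ∈ cl (X ∪ Y) v := mem_cl_comm.1 (cl_mono Finset.subset_union_right b hvY)
    exact mem_cl_trans hav hvb
  · have hav : v ∈ cl (X ∪ Y) a := cl_mono Finset.subset_union_left a hvK
    have hvb : b ∈ cl (X ∪ Y) v := mem_cl_comm.1 (cl_mono Finset.subset_union_right b hvY)
    have hbc' : c ∈ cl (X ∪ Y) b := cl_mono Finset.subset_union_right b hYbc
    exact mem_cl_trans (mem_cl_trans hav hvb) hbc'

/-! ### THEOREM R2 -/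

section Measure

variable (D : Finset (Sym2 V)) {p : Sym2 V → ℝ} (hp0 : ∀ e, 0 ≤ p e) (hp1 : ∀ e, p e ≤ 1) (a b c : V)
include hp0 hp1

/-- **THEOREM R2** (`s_a · u_a ≤ b₀ · t` on every finite weighted graph whose support joins the terminals):
`PrW(S_a) · PrW(U_a) ≤ PrW(B_0) · PrW(T)`, by the four functions theorem and `pointwise_R2`. [this work] -/
theorem r2_PrW (hDb : b ∈ cl D a) (hDc : c ∈ cl D a) :
    PrW D p (cellSa D a b c) * PrW D p (cellUa a b c) ≤
      PrW D p (cellB0 D a b c) * PrW D p (cellT a b c) :=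
  PrW_fourEvents D hp0 hp1 _ _ _ _ fun _ hS _ hT h1 h2 => pointwise_R2 hS hT hDb hDc h1 h2

end Measure

end RefinedRowR2

end Summit.CriticalPhenomena.PercolationContinuityZ3.Theorems

end
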